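import Summits.QuantumFields.YangMills.Theorems.AllWindowsColdBoxDirFreeVarOctantFlow
import HarnessLib

/-!
# Stub C `DirFreeVarLinear` (stmt-QuantumFields-24003) — part 2b: the energy of the octant flow is `O(H)`

Stub C of LINE-17 (`DirFreeVarLinear`, stmt-QuantumFields-24003) — part 2b: the energy of the Pólya octant flow.

* `sum_range_le_of_telescope`, `theta_sq_telescope`, `g_telescope`, `h_telescope`, `sum_theta_sq_le_four` — the series
  `Σ_{a,b,c ≥ 0} 4/((a+b+c+1)²(a+b+c+2)²) ≤ 4` by three telescopings (`(4/3)/(n+1)³`, `2/(n+1)²`, `4/(2n+1)`);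
* `octN_eq`, `sum_octW_sq_le` — per point the squared out-weights sum to at most `θ(n)² = 4/((n+1)²(n+2)²)`;
* `octW_energy_le` — **`Σ_p ψ_p² ≤ 4·(2H+2)`** for the time-constant octant chain (reindexing by `(x₀, a, b, c, k)`).

HONEST LABEL: helpers for ONE registered stub (C `DirFreeVarLinear`) of two critic-PASSed lines on the R2ξ″ RECORD-rung cruxes
24003/24006; no crux, rung or summit is proved; the Yang–Mills mass gap is NOT proved by this file.
-/

set_option autoImplicit false

noncomputable section

open MeasureTheory Matrix Finset
open Literature.MathematicalPhysics.QuantumFieldTheory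
open Literature.MathematicalPhysics.QuantumFieldTheory.LatticeMaxwell
open Literature.MathematicalPhysics.QuantumFieldTheory.AxialGauge
open Literature.Probability.LatticeModels (Site halfOpenBox mem_halfOpenBox)
open Summit.QuantumFields.YangMills.Theorems.WeakCouplingRates

namespace Summit.QuantumFields.YangMills.Theorems.AllWindowsColdBoxDirFreeVar

section Telescoping

/-! ### Energy of the octant flow: telescoping -/

/-- One-dimensional telescoping: `F(x) ≤ G(x) − G(x+1)` and `G ≥ 0` on `[0,∞)` give `Σ_{i<N} F(m+i) ≤ G(m)` for `m ≥ 0`. -/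
theorem sum_range_le_of_telescope (F G : ℝ → ℝ) (hFG : ∀ x : ℝ, 0 ≤ x → F x ≤ G x - G (x + 1))
    (hG : ∀ x : ℝ, 0 ≤ x → 0 ≤ G x) {m : ℝ} (hm : 0 ≤ m) (N : ℕ) :
    ∑ i ∈ Finset.range N, F (m + i) ≤ G m := by
  have h1 : ∑ i ∈ Finset.range N, F (m + i) ≤ ∑ i ∈ Finset.range N, (G (m + i) - G (m + (i + 1 : ℕ))) :=
    Finset.sum_le_sum fun i _ => by
      have := hFG (m + i) (by positivity)
      push_cast; rw [← add_assoc]; exact this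
  have h2 : ∑ i ∈ Finset.range N, (G (m + i) - G (m + (i + 1 : ℕ))) = G m - G (m + N) := by
    have := Finset.sum_range_sub' (fun i : ℕ => G (m + i)) N
    simpa using this
  have h3 : 0 ≤ G (m + N) := hG _ (by positivity)
  linarith

/-- The three telescoping majorants of `θ(n)² = 4/((n+1)²(n+2)²)`. -/
theorem theta_sq_telescope (x : ℝ) (hx : 0 ≤ x) :
    4 / ((x + 1) ^ 2 * (x + 2) ^ 2) ≤ 4 / 3 / (x + 1) ^ 3 - 4 / 3 / (x + 1 + 1) ^ 3 := by
  have key : 4 / 3 / (x + 1) ^ 3 - 4 / 3 / (x + 1 + 1) ^ 3 - 4 / ((x + 1) ^ 2 * (x + 2) ^ 2) =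
      4 / 3 / ((x + 1) ^ 3 * (x + 2) ^ 3) := by
    field_simp; ring
  have : 0 ≤ 4 / 3 / ((x + 1) ^ 3 * (x + 2) ^ 3) := by positivity
  linarith

/-- Second telescoping step: `(4/3)/(m+1)³ ≤ 2/(m+1)² − 2/(m+2)²`. -/
theorem g_telescope (x : ℝ) (hx : 0 ≤ x) : 4 / 3 / (x + 1) ^ 3 ≤ 2 / (x + 1) ^ 2 - 2 / (x + 1 + 1) ^ 2 := by
  have key : 2 / (x + 1) ^ 2 - 2 / (x + 1 + 1) ^ 2 - 4 / 3 / (x + 1) ^ 3 =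
      (8 * x ^ 2 + 14 * x + 2) / (3 * ((x + 1) ^ 3 * (x + 2) ^ 2)) := by
    field_simp; ring
  have : 0 ≤ (8 * x ^ 2 + 14 * x + 2) / (3 * ((x + 1) ^ 3 * (x + 2) ^ 2)) := by positivity
  linarith

/-- Third telescoping step: `2/(a+1)² ≤ 4/(2a+1) − 4/(2a+3)`. -/
theorem h_telescope (x : ℝ) (hx : 0 ≤ x) : 2 / (x + 1) ^ 2 ≤ 4 / (2 * x + 1) - 4 / (2 * (x + 1) + 1) := by
  have key : 4 / (2 * x + 1) - 4 / (2 * (x + 1) + 1) - 2 / (x + 1) ^ 2 =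
      2 / ((2 * x + 1) * (2 * x + 3) * (x + 1) ^ 2) := by
    field_simp; ring
  have : 0 ≤ 2 / ((2 * x + 1) * (2 * x + 3) * (x + 1) ^ 2) := by positivity
  linarith

/-- **The energy series of the Pólya octant flow is at most `4`**: `Σ_{a,b,c<N} 4/((a+b+c+1)²(a+b+c+2)²) ≤ 4`. -/
theorem sum_theta_sq_le_four (N : ℕ) :
    ∑ a ∈ Finset.range N, ∑ b ∈ Finset.range N, ∑ c ∈ Finset.range N,
      (4 : ℝ) / (((a : ℝ) + b + c + 1) ^ 2 * ((a : ℝ) + b + c + 2) ^ 2) ≤ 4 := by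
  -- innermost: `≤ (4/3)/(a+b+1)³`
  have h1 : ∀ a b : ℕ, ∑ c ∈ Finset.range N, (4 : ℝ) / (((a : ℝ) + b + c + 1) ^ 2 * ((a : ℝ) + b + c + 2) ^ 2) ≤
      4 / 3 / (((a : ℝ) + b) + 1) ^ 3 := fun a b => by
    have := sum_range_le_of_telescope (fun x => 4 / ((x + 1) ^ 2 * (x + 2) ^ 2)) (fun x => 4 / 3 / (x + 1) ^ 3)
      (fun x hx => theta_sq_telescope x hx) (fun x hx => by positivity) (m := (a : ℝ) + b) (by positivity) N
    refine le_trans (le_of_eq (Finset.sum_congr rfl fun c _ => ?_)) this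
    ring_nf
  -- middle: `≤ 2/(a+1)²`
  have h2 : ∀ a : ℕ, ∑ b ∈ Finset.range N, (4 : ℝ) / 3 / (((a : ℝ) + b) + 1) ^ 3 ≤ 2 / ((a : ℝ) + 1) ^ 2 := fun a =>
    sum_range_le_of_telescope (fun x => 4 / 3 / (x + 1) ^ 3) (fun x => 2 / (x + 1) ^ 2)
      (fun x hx => g_telescope x hx) (fun x hx => by positivity) (m := (a : ℝ)) (by positivity) N
  -- outer: `≤ 4`
  have h3 : ∑ a ∈ Finset.range N, (2 : ℝ) / ((a : ℝ) + 1) ^ 2 ≤ 4 := by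
    have := sum_range_le_of_telescope (fun x => 2 / (x + 1) ^ 2) (fun x => 4 / (2 * x + 1))
      (fun x hx => h_telescope x hx) (fun x hx => by positivity) (m := (0 : ℝ)) le_rfl N
    simpa using this
  calc ∑ a ∈ Finset.range N, ∑ b ∈ Finset.range N, ∑ c ∈ Finset.range N,
        (4 : ℝ) / (((a : ℝ) + b + c + 1) ^ 2 * ((a : ℝ) + b + c + 2) ^ 2)
      ≤ ∑ a ∈ Finset.range N, ∑ b ∈ Finset.range N, 4 / 3 / (((a : ℝ) + b) + 1) ^ 3 :=
        Finset.sum_le_sum fun a _ => Finset.sum_le_sum fun b _ => h1 a b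
    _ ≤ ∑ a ∈ Finset.range N, 2 / ((a : ℝ) + 1) ^ 2 := Finset.sum_le_sum fun a _ => h2 a
    _ ≤ 4 := h3

end Telescoping

/-! ### Energy of the octant flow: the bound `Σ ψ² ≤ 4·(2H+2)` -/

section Energy

variable {H : ℕ}

/-- `n(x)` spelled out over the three spatial directions. -/
theorem octN_eq (z₀ x : Site 4) :
    octN z₀ x = ((x 1 - z₀ 1 : ℤ) : ℝ) + ((x 2 - z₀ 2 : ℤ) : ℝ) + ((x 3 - z₀ 3 : ℤ) : ℝ) := by
  unfold octN
  have : ((Finset.univ : Finset (Fin 4)).erase 0) = {1, 2, 3} := by decide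
  rw [this, Finset.sum_insert (by decide), Finset.sum_insert (by decide), Finset.sum_singleton]
  ring

/-- Per-point energy: at the point `(t, z₀ + (a,b,c))` the squared out-weights sum to at most `θ(a+b+c)² = 4/((n+1)²(n+2)²)`. -/
theorem sum_octW_sq_le (z₀ : Site 4) (t : ℤ) (a b c : ℕ) :
    ∑ k : Fin 4, octW H z₀ (![t, z₀ 1 + a, z₀ 2 + b, z₀ 3 + c]) k ^ 2 ≤
      4 / ((((a : ℝ) + b + c) + 1) ^ 2 * (((a : ℝ) + b + c) + 2) ^ 2) := by
  set x : Site 4 := ![t, z₀ 1 + a, z₀ 2 + b, z₀ 3 + c] with hx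
  set n : ℝ := (a : ℝ) + b + c with hn
  have hN : octN z₀ x = n := by
    rw [octN_eq, hx]; simp; ring
  have hx1 : ((x 1 - z₀ 1 : ℤ) : ℝ) = a := by rw [hx]; simp
  have hx2 : ((x 2 - z₀ 2 : ℤ) : ℝ) = b := by rw [hx]; simp
  have hx3 : ((x 3 - z₀ 3 : ℤ) : ℝ) = c := by rw [hx]; simp
  have hn0 : 0 ≤ n := by positivity
  -- each spatial out-weight squared is at most `(θ (a_k+1)/(n+3))²`
  have hk : ∀ (k : Fin 4) (ak : ℝ), ((x k - z₀ k : ℤ) : ℝ) = ak →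
      octW H z₀ x k ^ 2 ≤ (2 / ((n + 1) * (n + 2)) * (ak + 1) / (n + 3)) ^ 2 := by
    intro k ak hak
    unfold octW
    split_ifs
    · rw [hN, hak]
    · rw [zero_pow two_ne_zero]; positivity
  rw [Fin.sum_univ_four, octW_zero, zero_pow two_ne_zero, zero_add]
  have h1 := hk 1 a hx1
  have h2 := hk 2 b hx2
  have h3 := hk 3 c hx3
  have hsq : ((a : ℝ) + 1) ^ 2 + ((b : ℝ) + 1) ^ 2 + ((c : ℝ) + 1) ^ 2 ≤ (n + 3) ^ 2 := by
    rw [hn]; nlinarith [mul_nonneg (Nat.cast_nonneg a : (0:ℝ) ≤ a) (Nat.cast_nonneg b : (0:ℝ) ≤ b),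
      mul_nonneg (Nat.cast_nonneg a : (0:ℝ) ≤ a) (Nat.cast_nonneg c : (0:ℝ) ≤ c),
      mul_nonneg (Nat.cast_nonneg b : (0:ℝ) ≤ b) (Nat.cast_nonneg c : (0:ℝ) ≤ c)]
  have hθ : (2 / ((n + 1) * (n + 2))) ^ 2 = 4 / ((n + 1) ^ 2 * (n + 2) ^ 2) := by
    rw [div_pow, mul_pow]; norm_num
  calc octW H z₀ x 1 ^ 2 + octW H z₀ x 2 ^ 2 + octW H z₀ x 3 ^ 2
      ≤ (2 / ((n + 1) * (n + 2)) * ((a : ℝ) + 1) / (n + 3)) ^ 2 + (2 / ((n + 1) * (n + 2)) * ((b : ℝ) + 1) / (n + 3)) ^ 2 +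
          (2 / ((n + 1) * (n + 2)) * ((c : ℝ) + 1) / (n + 3)) ^ 2 := by linarith
    _ = (2 / ((n + 1) * (n + 2))) ^ 2 * ((((a : ℝ) + 1) ^ 2 + ((b : ℝ) + 1) ^ 2 + ((c : ℝ) + 1) ^ 2) / (n + 3) ^ 2) := by
          field_simp
    _ ≤ (2 / ((n + 1) * (n + 2))) ^ 2 * 1 :=
          mul_le_mul_of_nonneg_left ((div_le_one (by positivity)).2 hsq) (sq_nonneg _)
    _ = 4 / ((n + 1) ^ 2 * (n + 2) ^ 2) := by rw [mul_one, hθ]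

/-- **Energy of the octant flow.**  For a source with nonnegative spatial coordinates, the 2-chain `ψ(x,0,k) = octW x k` has
`Σ_p ψ_p² ≤ 4·(2H+2)` (`2H+2` time slices times the octant energy `≤ 4`). -/
theorem octW_energy_le (z₀ : Site 4) (hz₀ : ∀ j : Fin 4, j ≠ 0 → 0 ≤ z₀ j) :
    ∑ p ∈ plaquettesIn (halfOpenBox 4 (2 * H + 3)),
      (if (Plaq.shift dirCorner p).2.1 = 0 then octW H z₀ (Plaq.shift dirCorner p).1 (Plaq.shift dirCorner p).2.2 else 0) ^ 2 ≤
      4 * (2 * (H : ℝ) + 2) := by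
  classical
  set f : Plaq 4 → ℝ := fun q => (if q.2.1 = 0 then octW H z₀ q.1 q.2.2 else 0) ^ 2 with hf
  set R := Finset.range (2 * H + 1) with hR
  set U : Finset (ℤ × ((ℕ × ℕ) × ℕ) × Fin 4) :=
    (Finset.Icc (-1 : ℤ) (2 * H)) ×ˢ (((R ×ˢ R) ×ˢ R) ×ˢ (Finset.univ : Finset (Fin 4))) with hU
  set ι : ℤ × ((ℕ × ℕ) × ℕ) × Fin 4 → Plaq 4 :=
    fun u => ((![u.1, z₀ 1 + u.2.1.1.1, z₀ 2 + u.2.1.1.2, z₀ 3 + u.2.1.2] : Site 4), 0, u.2.2) with hι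
  have hfnn : ∀ q, 0 ≤ f q := fun q => sq_nonneg _
  -- injectivity of the parametrisation
  have hinj : Set.InjOn ι U := by
    intro u _ u' _ h
    simp only [hι, Prod.mk.injEq] at h
    obtain ⟨hv, -, hk⟩ := h
    have h0 := congrFun hv 0; have h1 := congrFun hv 1; have h2 := congrFun hv 2; have h3 := congrFun hv 3
    simp at h0 h1 h2 h3
    ext <;> simp_all
  -- support
  have hsupp : ∀ q, f q ≠ 0 → ∃ u ∈ U, ι u = q := by
    intro q hq
    obtain ⟨x, i, k⟩ := q
    simp only [hf, ne_eq, pow_eq_zero_iff two_ne_zero] at hq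
    split_ifs at hq with hi
    · subst hi
      unfold octW at hq
      split_ifs at hq with hc
      · obtain ⟨hk, ht, hsp⟩ := hc
        have h1 := hsp 1 (by decide); have h2 := hsp 2 (by decide); have h3 := hsp 3 (by decide)
        have g1 := hz₀ 1 (by decide); have g2 := hz₀ 2 (by decide); have g3 := hz₀ 3 (by decide)
        refine ⟨(x 0, (((x 1 - z₀ 1).toNat, (x 2 - z₀ 2).toNat), (x 3 - z₀ 3).toNat), k), ?_, ?_⟩
        · simp only [hU, hR, Finset.mem_product, Finset.mem_Icc, Finset.mem_range, Finset.mem_univ, and_true]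
          refine ⟨⟨ht.1, ht.2⟩, ⟨?_, ?_⟩, ?_⟩ <;> omega
        · simp only [hι]
          refine Prod.ext ?_ rfl
          funext j
          fin_cases j <;> simp <;> omega
      · exact absurd rfl hq
    · exact absurd rfl hq
  refine (sum_index_le_sum_param U ι hinj f hfnn hsupp).trans ?_
  -- the parametrised sum factorises: time slices × octant energy
  rw [hU, Finset.sum_product]
  have hslice : ∀ t : ℤ, ∑ u ∈ ((R ×ˢ R) ×ˢ R) ×ˢ (Finset.univ : Finset (Fin 4)), f (ι (t, u)) ≤ 4 := by
    intro t
    rw [Finset.sum_product, Finset.sum_product, Finset.sum_product]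
    have hpt : ∀ a b c : ℕ, ∑ k : Fin 4, f (ι (t, ((a, b), c), k)) ≤
        4 / ((((a : ℝ) + b + c) + 1) ^ 2 * (((a : ℝ) + b + c) + 2) ^ 2) := fun a b c => by
      have := sum_octW_sq_le (H := H) z₀ t a b c
      simpa [hf, hι] using this
    calc ∑ a ∈ R, ∑ b ∈ R, ∑ c ∈ R, ∑ k : Fin 4, f (ι (t, ((a, b), c), k))
        ≤ ∑ a ∈ R, ∑ b ∈ R, ∑ c ∈ R, 4 / ((((a : ℝ) + b + c) + 1) ^ 2 * (((a : ℝ) + b + c) + 2) ^ 2) :=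
          Finset.sum_le_sum fun a _ => Finset.sum_le_sum fun b _ => Finset.sum_le_sum fun c _ => hpt a b c
      _ ≤ 4 := sum_theta_sq_le_four (2 * H + 1)
  calc ∑ t ∈ Finset.Icc (-1 : ℤ) (2 * H), ∑ u ∈ ((R ×ˢ R) ×ˢ R) ×ˢ (Finset.univ : Finset (Fin 4)), f (ι (t, u))
      ≤ ∑ t ∈ Finset.Icc (-1 : ℤ) (2 * H), (4 : ℝ) := Finset.sum_le_sum fun t _ => hslice t
    _ = 4 * (2 * (H : ℝ) + 2) := by
        rw [Finset.sum_const, nsmul_eq_mul, Int.card_Icc]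
        have : (2 * (H : ℤ) + 1 - -1).toNat = 2 * H + 2 := by omega
        rw [this]; push_cast; ring

end Energy

end Summit.QuantumFields.YangMills.Theorems.AllWindowsColdBoxDirFreeVar

end
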